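/-
ι₁ ∕ Id CHAIN TWIN (ASSEMBLER d2bridge-plan g3 MODULE TABLE v1.2, rows I6∕I7, pen prove-3 g3 = prover-pub-hodgecm2-d2bridge-prove-3-g3-0;
coordinator ruling «WORLD = C», pub-hodgecm2/INBOX l.12481, item (4) «(c)+(d) closure at ι₁»): the accepted module of the same name under
`CorCM/D2Bridge/` RE-TYPED over the UNTWISTED honest Prop-C.5 datum `Model.honestP5IdOf h F ι₁ V Φ` (✔-pending `HComp/HonestP5Id.lean`,
instlevel-a) and the J2 interface `ComponentAlbaneseId` (`D2Bridge/Iota1/ComponentAlbanese.lean`, pin-a) — instance = tail = key = ι₁.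
MECHANICAL TOKEN FLIP (`Model.honestP5Of ↦ Model.honestP5IdOf`, `ComponentAlbanese ↦ ComponentAlbaneseId`, namespace
`…CorCM.D2Bridge ↦ …CorCM.D2Bridge.Iota1`); statements, proofs and docstrings otherwise BYTE-IDENTICAL to the twisted original, which stays
as landed.  HC_CM is NOT proved; «Δ2 BRIDGE CLOSED» is NOT claimed.
ORIGINAL HEADER FOLLOWS.
Copyright (c) 2026 the pub-hodgecm2 formalisation cell (harness21).  New file, outside the frozen port manifest.
Origin: seat `prover-pub-hodgecm2-d2bridge-prove-2-g1-0` (Δ2 BRIDGE team; ASSEMBLER DECISION #7 (3), pub-hodgecm2/INBOX l.10974: the S2 PIN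
`Map43RecordAtPin`; part 2 of 2 = THEOREMS ONLY), 2026-08-23.  No `def`, no named fact, no `sorry`, no new axiom; HC_CM is NOT proved.
-/
import Summits.HodgeConjecture.CorCM.D2Bridge.Iota1.Map43RecordAtPinLevels
import HarnessLib

set_option autoImplicit false

/-!
# Δ2 bridge, the S2 PIN (part 2, theorems): unfoldings of the record, the S₀ binders, the S2 law `P_eq`, the S3/S4 junction

Y. Liu, *Fourier–Jacobi cycles and arithmetic relative trace formula*, Camb. J. Math. **9** (2021) 1–147 = arXiv:2102.11518 [Liu2021];
TeX source `FJcycle.tex` (`l. NNNN` = its lines).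

Part 1 (`Map43RecordAtPinLevels.lean`) DEFINES, from the J2 interface `J : ComponentAlbaneseId …` («Albanese on components»), the level-wise
Betti data `levelwisePin J … Dμ` and THE RECORD `map43RecordAtPin J … Dμ τ' hτ' : (toThm418Data C (T.restOne …)).Map43RationalData`
([Liu2021] proof of Thm. 4.18, l. 2247–2253; the Δ2 binder group R2 «`M`») with all four `P`-laws discharged.  THIS FILE (theorems only):

* §5 `ρUPin_apply ∕ ρBPin_apply` (`rfl`), `map43RecordAtPin_P` (the record's `P` IS the constructed (4.2), `rfl` — the `hMP` of
  `map42_P_eq`), `map43RecordAtPin_ρB_apply`, `jHPin_injective`, `jHPin_comm` — the S₀ binders at the pin: `jH := jHPin = LinearMap.id` into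
  `Tower … V = T.H` (injective) and `hjH`: `ρB g x = of g • x` (J1 `towerRep_eq_of_smul`);
* §6 **`P_eq_pin`** — VERBATIM the field `HcmPieces.P_eq` for `M := map43RecordAtPin …` and the S2 field terms `AKPin K` (`ℂ ⊗_ℚ
  H¹_B((A_{levelOf K} ⊗ ℂ)(ℂ); ℚ)`), `phiStarPin` (`(φ ⊗ ℂ)^* ⊗ ℂ`), `transKPin` (`ιT ∘ (ofQ Γ_{levelOf K} ∘ albStarQ (levelOf K)) ⊗ ℂ`) (`map42_P_eq … rfl`); and the S3/S4 junction **`resTotal_ιT_tmul_transKQ`**: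
  restricting a transported class to the identity component `P_K` (`resTotal K`, `Γ_{K₁} = K`) is pulling back along `t_1 ≫ alb K₁ 1`
  (so S3 := `XK := AK`, `albK := refl`, `resX := (t_1 ≫ alb K₁ 1)^* ⊗ ℂ`; S4's composite morphism is `t_1 ≫ alb K₁ 1 ≫ f_ℂ`).

Nothing about Liu's objects is asserted; HC_CM is NOT proved; «Δ2 BRIDGE CLOSED» is NOT claimed.

## References
* [Liu2021] §2.1 Lem. 2.4 (1) with proof (l. 1210–1228); §4.2 l. 2062–2081; Rem. 4.17 (l. 2226–2228); Thm. 4.18 (1) (l. 2239); proof of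
  Thm. 4.18, map (4.2)/(4.3) (l. 2247–2253).
* Tree: `CorCM/D2Bridge/Map43RecordAtPinLevels.lean` (part 1), `OmegaLevelwisePullback[Laws].lean`, `TowerRationalForm[Equivariant].lean` (J1).
-/

noncomputable section

open scoped TensorProduct
open CategoryTheory NumberField Function
open Literature.AlgebraicGeometry.Motives (AbelianVariety bettiCohomology)
open Literature.AlgebraicGeometry.HodgeTheory
open Literature.AlgebraicGeometry.ShimuraVarieties.UnitaryCanonicalModel (exists_recordSystem)
open Literature.NumberTheory.Automorphic Literature.NumberTheory.Automorphic.Liu2021 Literature.NumberTheory.Automorphic.Liu2021.AppendixC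
open Literature.NumberTheory.Automorphic.Liu2021.AppendixC.RestOne
open Literature.NumberTheory.Automorphic.PicardCM
open Literature.NumberTheory.Transcendental (Arapura2012_Cor_15_4_6)
open HodgeCM.Model.LevelTranslate HodgeCM.Model.TowerLevel HodgeCM.Model.TowerCarrier
open Summit.HodgeConjecture.CorCM.D2Bridge.TowerRational

namespace Summit.HodgeConjecture.CorCM.D2Bridge.Iota1

/-! Every named tree fact (`hHD`, `hI`, `hA`, `h`) is an explicit per-theorem binder (no section `variable` carries a named Prop); the explicit
argument order of every theorem is the one of part 1 (`J emb ιg hμ hw Car Eps epsOf Chi omega rho Dμ τ' hτ' …`). -/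

variable {hU : BallQuotientUniformisedDatum} {h₃ : CMAbelianVarietyRealised}
variable {L : HodgeCM.CMField} {ι₁ : L →+* ℂ} {V : HodgeCM.HermSpace3 L ι₁} {Φ : Literature.AlgebraicGeometry.Motives.CMType L}
  {isotropicAt : ℕ → Prop} [Algebra L ℂ]
variable {Lg : Type} [Field Lg] [NumberField Lg] [IsGalois ℚ Lg] {μ : Literature.NumberTheory.Automorphic.IdeleClassGroup L →ₜ* Circle}

section Pin

/-! ## §5  The record at the pin: unfoldings and the S₀ binders -/

omit [Algebra L ℂ] in
/-- Unfolding (`rfl`). [folklore] -/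
theorem ρUPin_apply {hHD : exists_isReal_hodgeModel} {hI : hodgePQ_independent_of_hodgeModel} {hA : Arapura2012_Cor_15_4_6}
    {h : exists_recordSystem}
    {C : Sec42Data (Model.honestP5IdOf h ⟨L.K⟩ ι₁ ⟨V.Hm, V.isHermitian, V.signature_ι₁, V.posDef_of_ne⟩ Φ) isotropicAt}
    (g : ↥V.adelicFin) : ρUPin hHD hI hU h₃ hA C g = towerRepQ hHD hI hU h₃ hA V g := rfl

omit [Algebra L ℂ] in
/-- Unfolding (`rfl`): with `jH := LinearMap.id` the S₀ binder `hjH` is J1's `towerRep_eq_of_smul`. [folklore] -/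
theorem ρBPin_apply {hHD : exists_isReal_hodgeModel} {hI : hodgePQ_independent_of_hodgeModel} {hA : Arapura2012_Cor_15_4_6}
    {h : exists_recordSystem}
    {C : Sec42Data (Model.honestP5IdOf h ⟨L.K⟩ ι₁ ⟨V.Hm, V.isHermitian, V.signature_ι₁, V.posDef_of_ne⟩ Φ) isotropicAt}
    (g : ↥V.adelicFin) : ρBPin hHD hI hU h₃ hA C g = towerRep hHD hI hU h₃ hA V g := rfl


/-- The record's pull-back IS the constructed (4.2) (by `rfl`; the hypothesis `hMP` of `map42_P_eq`). [cite: Liu2021, proof of Thm. 4.18 (FJcycle.tex l. 2248–2250)] -/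
theorem map43RecordAtPin_P {hHD : exists_isReal_hodgeModel} {hI : hodgePQ_independent_of_hodgeModel} {hA : Arapura2012_Cor_15_4_6}
    {h : exists_recordSystem}
    {C : Sec42Data (Model.honestP5IdOf h ⟨L.K⟩ ι₁ ⟨V.Hm, V.isHermitian, V.signature_ι₁, V.posDef_of_ne⟩ Φ) isotropicAt}
    {T : C.HeckeTranslates} (J : ComponentAlbaneseId hHD hI hU h₃ hA V h Φ C T)
    (emb : L →ₐ[ℚ] Lg) (ιg : Lg →+* ℂ) (hμ : Literature.NumberTheory.Automorphic.IdeleClassGroup.IsConjugateSymplectic L μ)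
    (hw : Literature.NumberTheory.Automorphic.IdeleClassGroup.HasWeight L μ 1) (Car : Def45.Carriers L μ)
    (Eps : Type) (epsOf : L → Eps) (Chi : Type) (omega : Eps → Chi → Type)
    [∀ ε χ, AddCommGroup (omega ε χ)] [∀ ε χ, Module ℂ (omega ε χ)] (rho : ∀ ε χ, Representation ℂ C.G (omega ε χ))
    (Dμ : ObjOne emb ιg hμ hw Car) (τ' : L →+* ℂ) (hτ' : τ' ∈ hμ.cmType.1) :
    (map43RecordAtPin J emb ιg hμ hw Car Eps epsOf Chi omega rho Dμ τ' hτ').P =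
      PΩOne C emb ιg hμ hw Car Dμ (levelwisePin J emb ιg hμ hw Car Dμ) :=
  rfl

/-- **The S₀ binders `jH ∕ hjHinj ∕ hjH` at the pin**: the record's complex carrier `HB` IS the model's tower `Tower … V` (`= T.H` at
`LiuDictionary.ofTower`, `rfl`), read by `jH := LinearMap.id` (injective); and `ρB g x = of g • x` — the record's `ρB` is `towerRep`, which IS
the `ℂ[U(V)(𝔸_f)]`-module structure of the tower (J1 `towerRep_eq_of_smul`). [cite: Liu2021, §4.2 (FJcycle.tex l. 2074–2081)] -/
theorem map43RecordAtPin_ρB_apply {hHD : exists_isReal_hodgeModel} {hI : hodgePQ_independent_of_hodgeModel} {hA : Arapura2012_Cor_15_4_6}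
    {h : exists_recordSystem}
    {C : Sec42Data (Model.honestP5IdOf h ⟨L.K⟩ ι₁ ⟨V.Hm, V.isHermitian, V.signature_ι₁, V.posDef_of_ne⟩ Φ) isotropicAt}
    {T : C.HeckeTranslates} (J : ComponentAlbaneseId hHD hI hU h₃ hA V h Φ C T)
    (emb : L →ₐ[ℚ] Lg) (ιg : Lg →+* ℂ) (hμ : Literature.NumberTheory.Automorphic.IdeleClassGroup.IsConjugateSymplectic L μ)
    (hw : Literature.NumberTheory.Automorphic.IdeleClassGroup.HasWeight L μ 1) (Car : Def45.Carriers L μ)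
    (Eps : Type) (epsOf : L → Eps) (Chi : Type) (omega : Eps → Chi → Type)
    [∀ ε χ, AddCommGroup (omega ε χ)] [∀ ε χ, Module ℂ (omega ε χ)] (rho : ∀ ε χ, Representation ℂ C.G (omega ε χ))
    (Dμ : ObjOne emb ιg hμ hw Car) (τ' : L →+* ℂ) (hτ' : τ' ∈ hμ.cmType.1)
    (g : ↥V.adelicFin) (x : Tower hHD hI hU h₃ hA V) :
    (map43RecordAtPin J emb ιg hμ hw Car Eps epsOf Chi omega rho Dμ τ' hτ').ρB g x = MonoidAlgebra.of ℂ ↥V.adelicFin g • x :=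
  towerRep_eq_of_smul hHD hI hU h₃ hA g x

/-- `jHPin = id` is injective (the S₀ binder `hjHinj`). [folklore] -/
theorem jHPin_injective {hHD : exists_isReal_hodgeModel} {hI : hodgePQ_independent_of_hodgeModel} {hA : Arapura2012_Cor_15_4_6}
    {h : exists_recordSystem}
    {C : Sec42Data (Model.honestP5IdOf h ⟨L.K⟩ ι₁ ⟨V.Hm, V.isHermitian, V.signature_ι₁, V.posDef_of_ne⟩ Φ) isotropicAt}
    {T : C.HeckeTranslates} (J : ComponentAlbaneseId hHD hI hU h₃ hA V h Φ C T)
    (emb : L →ₐ[ℚ] Lg) (ιg : Lg →+* ℂ) (hμ : Literature.NumberTheory.Automorphic.IdeleClassGroup.IsConjugateSymplectic L μ)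
    (hw : Literature.NumberTheory.Automorphic.IdeleClassGroup.HasWeight L μ 1) (Car : Def45.Carriers L μ)
    (Eps : Type) (epsOf : L → Eps) (Chi : Type) (omega : Eps → Chi → Type)
    [∀ ε χ, AddCommGroup (omega ε χ)] [∀ ε χ, Module ℂ (omega ε χ)] (rho : ∀ ε χ, Representation ℂ C.G (omega ε χ))
    (Dμ : ObjOne emb ιg hμ hw Car) (τ' : L →+* ℂ) (hτ' : τ' ∈ hμ.cmType.1) :
    Function.Injective (jHPin J emb ιg hμ hw Car Eps epsOf Chi omega rho Dμ τ' hτ') :=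
  fun _ _ e => e

/-- The S₀ binder `hjH` through `jHPin`: `jH (ρB g x) = of g • jH x`. [cite: Liu2021, §4.2 (FJcycle.tex l. 2074–2081)] -/
theorem jHPin_comm {hHD : exists_isReal_hodgeModel} {hI : hodgePQ_independent_of_hodgeModel} {hA : Arapura2012_Cor_15_4_6}
    {h : exists_recordSystem}
    {C : Sec42Data (Model.honestP5IdOf h ⟨L.K⟩ ι₁ ⟨V.Hm, V.isHermitian, V.signature_ι₁, V.posDef_of_ne⟩ Φ) isotropicAt}
    {T : C.HeckeTranslates} (J : ComponentAlbaneseId hHD hI hU h₃ hA V h Φ C T)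
    (emb : L →ₐ[ℚ] Lg) (ιg : Lg →+* ℂ) (hμ : Literature.NumberTheory.Automorphic.IdeleClassGroup.IsConjugateSymplectic L μ)
    (hw : Literature.NumberTheory.Automorphic.IdeleClassGroup.HasWeight L μ 1) (Car : Def45.Carriers L μ)
    (Eps : Type) (epsOf : L → Eps) (Chi : Type) (omega : Eps → Chi → Type)
    [∀ ε χ, AddCommGroup (omega ε χ)] [∀ ε χ, Module ℂ (omega ε χ)] (rho : ∀ ε χ, Representation ℂ C.G (omega ε χ))
    (Dμ : ObjOne emb ιg hμ hw Car) (τ' : L →+* ℂ) (hτ' : τ' ∈ hμ.cmType.1)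
    (g : ↥V.adelicFin) (x : (map43RecordAtPin J emb ιg hμ hw Car Eps epsOf Chi omega rho Dμ τ' hτ').HB) :
    jHPin J emb ιg hμ hw Car Eps epsOf Chi omega rho Dμ τ' hτ'
        ((map43RecordAtPin J emb ιg hμ hw Car Eps epsOf Chi omega rho Dμ τ' hτ').ρB g x) =
      MonoidAlgebra.of ℂ ↥V.adelicFin g • jHPin J emb ιg hμ hw Car Eps epsOf Chi omega rho Dμ τ' hτ' x :=
  towerRep_eq_of_smul hHD hI hU h₃ hA g x

/-! ## §6  The S2 fields of `HcmPieces` at the pin, `P_eq`, and the S3/S4 junction -/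

/-- **S2 law `P_eq` at the pin** — VERBATIM the field `HcmPieces.P_eq` for `M := map43RecordAtPin …`, `AK := AKPin K`,
`phiStar := phiStarPin … K`, `transK := transKPin J K`: `M.ι ((M.P (res K M.Dμ φ)) ⊗ α) = transK (phiStar φ α)` — the level-`K` law of the
constructed (4.2) (`map42_P_eq` with `hMP := rfl`). [cite: Liu2021, Rem. 4.17 (FJcycle.tex l. 2226–2228), Thm. 4.18 (1) (l. 2239), proof of Thm. 4.18 (l. 2247–2253)] -/
theorem P_eq_pin {hHD : exists_isReal_hodgeModel} {hI : hodgePQ_independent_of_hodgeModel} {hA : Arapura2012_Cor_15_4_6}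
    {h : exists_recordSystem}
    {C : Sec42Data (Model.honestP5IdOf h ⟨L.K⟩ ι₁ ⟨V.Hm, V.isHermitian, V.signature_ι₁, V.posDef_of_ne⟩ Φ) isotropicAt}
    {T : C.HeckeTranslates} (J : ComponentAlbaneseId hHD hI hU h₃ hA V h Φ C T)
    (emb : L →ₐ[ℚ] Lg) (ιg : Lg →+* ℂ) (hμ : Literature.NumberTheory.Automorphic.IdeleClassGroup.IsConjugateSymplectic L μ)
    (hw : Literature.NumberTheory.Automorphic.IdeleClassGroup.HasWeight L μ 1) (Car : Def45.Carriers L μ)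
    (Eps : Type) (epsOf : L → Eps) (Chi : Type) (omega : Eps → Chi → Type)
    [∀ ε χ, AddCommGroup (omega ε χ)] [∀ ε χ, Module ℂ (omega ε χ)] (rho : ∀ ε χ, Representation ℂ C.G (omega ε χ))
    (Dμ : ObjOne emb ιg hμ hw Car) (τ' : L →+* ℂ) (hτ' : τ' ∈ hμ.cmType.1) (K : Subgroup C.G)
    (φ : (toThm418Data C (T.restOne emb ιg hμ hw Car Eps epsOf Chi omega rho)).HomK K Dμ) :
    (map43RecordAtPin J emb ιg hμ hw Car Eps epsOf Chi omega rho Dμ τ' hτ').ι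
        (((map43RecordAtPin J emb ιg hμ hw Car Eps epsOf Chi omega rho Dμ τ' hτ').P
            ((toThm418Data C (T.restOne emb ιg hμ hw Car Eps epsOf Chi omega rho)).res K Dμ φ)).baseChange ℂ
          (map43RecordAtPin J emb ιg hμ hw Car Eps epsOf Chi omega rho Dμ τ' hτ').α) =
      transKPin J K (phiStarPin J emb ιg hμ hw Car Eps epsOf Chi omega rho Dμ K φ
        (map43RecordAtPin J emb ιg hμ hw Car Eps epsOf Chi omega rho Dμ τ' hτ').α) :=
  map42_P_eq C emb ιg hμ hw Car Eps epsOf Chi omega rho (T.rhoΩOne emb ιg hμ hw Car)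
    (map43RecordAtPin J emb ιg hμ hw Car Eps epsOf Chi omega rho Dμ τ' hτ') (levelwisePin J emb ιg hμ hw Car Dμ) rfl K φ

/-- **The S3/S4 junction — the identity-component value of a transported class**: reading the class `x ∈ H¹(A_{K₁} ⊗ ℂ; ℚ)` into the tower
(`ofQ Γ_{K₁} (albStarQ K₁ x)`, complexified by `ιT`) and restricting to the identity component `P_K` (`resTotal K`, `Γ_{K₁} = K`) gives the
pull-back of `x` along `t_1 ≫ alb K₁ 1 : P_K ⟶ P_{Γ_{K₁},1} ⟶ A_{K₁} ⊗ ℂ` — J1's level law `resTotal_ιT_tmul_ofQ` + the definition of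
`resQ`.  With it S3's `tower_eq` is `XK := AK`, `albK := refl`, `resX := (t_1 ≫ alb K₁ 1)^* ⊗ ℂ`, and S4's composite morphism is
`t_1 ≫ alb K₁ 1 ≫ f_ℂ`. [cite: Liu2021, Lem. 2.4 (1) (FJcycle.tex l. 1210–1228) and §4.2 (l. 2066–2072)] -/
theorem resTotal_ιT_tmul_transKQ {hHD : exists_isReal_hodgeModel} {hI : hodgePQ_independent_of_hodgeModel} {hA : Arapura2012_Cor_15_4_6}
    {h : exists_recordSystem}
    {C : Sec42Data (Model.honestP5IdOf h ⟨L.K⟩ ι₁ ⟨V.Hm, V.isHermitian, V.signature_ι₁, V.posDef_of_ne⟩ Φ) isotropicAt}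
    {T : C.HeckeTranslates} (J : ComponentAlbaneseId hHD hI hU h₃ hA V h Φ C T)
    {K₁ : C5.SmallLevel C.S.K₀} {K : HodgeCM.Level V} (e : J.Γof K₁ = K)
    (ht : TransCond ((1 : ↥(Urat V)) : GL (Fin 3) L) K ((J.Γof K₁).conj 1 (J.belowConjThree K₁))) (z : ℂ)
    (x : bettiCohomology ((C.A K₁).baseChange ℂ).X 1) :
    resTotal hHD hI hU h₃ hA K
        (ιT hHD hI hU h₃ hA V (z ⊗ₜ[ℚ] ofQ hHD hI hU h₃ hA (J.Γof K₁) (J.belowConjThree K₁) (J.albStarQ K₁ x))) =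
      z ⊗ₜ[ℚ] BettiUniverse.pull
        (transMorU hU h₃ hHD hI hA (1 : ↥(Urat V)).2 K ((J.Γof K₁).conj 1 (J.belowConjThree K₁)) ht ≫ J.alb K₁ 1) 1 x := by
  subst e
  rw [resTotal_ιT_tmul_ofQ, BettiUniverse.pull_comp]
  rfl

end Pin

end Summit.HodgeConjecture.CorCM.D2Bridge.Iota1

end
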